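import Mathlib.LinearAlgebra.Matrix.Rank
import Mathlib.LinearAlgebra.Matrix.Kronecker
import Literature.Computability.AlgebraicComplexity.DTensorStrassenPreorder
import Literature.Computability.AlgebraicComplexity.OuterProductRank
import HarnessLib

/-!
# The flattening (gauge) points `ζ^{(S)}` of the asymptotic spectrum of `d`-tensors

Topic `Literature/Computability/AlgebraicComplexity`; sequel to `DTensorStrassenPreorder.lean`
(`asymptoticSpectrumDTensors K d' = X(T_{d'+2}(K), ≤)`). Christandl–Vrana–Zuiddam, Example 1.4
[corpus: paper:arxiv-1709.07851 p0005:L46–L49]: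

> "In [Strassen 1988] `k` universal spectral points are given. Namely, given a multilinear map
> `f : 𝔽^{n₁} × ⋯ × 𝔽^{n_k} → 𝔽`, let `V₁ = {v ∈ 𝔽^{n₁} : f(v, 𝔽^{n₂}, …, 𝔽^{n_k}) ≠ {0}}`† and similarly
> define `V_i` for `i ≥ 2`. Define `ζ_(i) : f ↦ dim V_i`. The maps `ζ_(i)` are universal spectral points and
> are named gauge points."

(† i.e. the rank of the flattening of `f` along leg `i`.) More generally, grouping the legs into a
bipartition `S ⊔ Sᶜ` and flattening to a matrix gives the **flattening ranks** `ζ^{(S)}(t) = rank (flat_S t)`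
(Alman–Li–Pratt 2026, §1 p. 5: "The most basic spectral points come from flattenings: one may regard `T`
as an element of `U ⊗ (V ⊗ W)` … and take its matrix rank … which Strassen called the gauge points
(Eichpunkte) [Str88, pp. 120], also known as flattening ranks"; Remark 3.2, p. 31: "We indeed have
spectral points that are not of the form `ζ_(κ)`, for example the flattening rank along the bipartition
`{{1,2},{3,4}}`" [corpus: paper:arxiv-2604.01386 p0005:L13–L16, p0031:L8–L9]); for `∅ ≠ S ≠ [d]` these
are monotone under restriction, multiplicative under `⊗`, additive under `⊕` and normalised
(`ζ^{(S)}(⟨n⟩) = n`), i.e. points of `X_d` (for `k = 3` the three gauge points are the only flattenings;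
the requester's "flattening (grouping) spectral points `ζ^{(S)}` for `S ⊂ Fin d`"). This file PROVES all
four properties and the membership in `asymptoticSpectrumDTensors`.

## Content

* `DTensor.merge p r c` / `DTensor.flatS p t` — the flattening of `t : (Fin d → ι) → K` along the split
  `p : Fin d → Prop` of the legs: the matrix `(S → ι) × (Sᶜ → ι) → K`, `(r, c) ↦ t (r ⊔ c)`
  (`S = {j | p j}`); `rowMat`/`colMat` (`⊗_{j ∈ S} A_j`, `⊗_{j ∉ S} A_j`) and
  **`flatS_apply`**: `flat_S (A·t) = (⊗_S A) · flat_S t · (⊗_{Sᶜ} A)ᵀ`; hence **`rank_flatS_mono`**.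
* **`rank_kroneckerMap_mul`** — `rank (A ⊗ₖ B) = rank A · rank B` over a field (via the tree's
  `OuterProductRank.finrank_span_outerFun`; not in Mathlib at the pin); `flatS_kron`, **`rank_flatS_kron`**.
* `flatS_unit`, **`rank_flatS_unit`** (`= |ι|` when `S`, `Sᶜ ≠ ∅`).
* **`rank_flatS_dsum`** — additivity under `⊕` (the row space of `flat_S (t ⊕ t')` is the direct sum of
  the zero-extended row spaces).
* `DTensorClass.gaugeRank p x` — `ζ^{(S)}` on classes (`gaugeRank_mk`), and
  **`DTensorClass.gaugeRank_mem_asymptoticSpectrumDTensors`** — `ζ^{(S)} ∈ X_d` for `∅ ≠ S ≠ [d]`.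

## References

* M. Christandl, P. Vrana, J. Zuiddam, JAMS 36 (2023) = arXiv:1709.07851, Example 1.4 (gauge points).
  [ChristandlVranaZuiddam2023]
* V. Strassen, *The asymptotic spectrum of tensors*, Crelle 384 (1988), p. 120 (Eichpunkte). [Strassen1988]
* J. Alman, B. Li, K. Pratt, *The edge of the asymptotic spectrum of tensors*, arXiv:2604.01386 (2026),
  §1 (p. 5), Remark 3.2 (p. 31): flattening ranks along bipartitions are spectral points. [AlmanLiPratt2026]

Everything is proved; no named facts, no instances, no notation. Grades: single-leg gauge points REFEREED
(CVZ 2023 / Strassen 1988); bipartition flattening ranks as spectral points: the statement is printed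
in the PREPRINT Alman–Li–Pratt 2026 (and is in any case a theorem here).
-/

noncomputable section

open scoped BigOperators

namespace Literature.Computability.AlgebraicComplexity

universe u

namespace DTensor

section Defs

variable {K : Type u} {d : ℕ} (p : Fin d → Prop) [DecidablePred p]
variable {ι κ : Type*}

/-- Merge a row multi-index on `S = {j | p j}` and a column multi-index on `Sᶜ` into a multi-index on all
legs. [cite: ChristandlVranaZuiddam2023, Example 1.4] -/
def merge (r : {j // p j} → ι) (c : {j // ¬p j} → ι) : Fin d → ι :=
  fun j => if h : p j then r ⟨j, h⟩ else c ⟨j, h⟩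

/-- `merge` on a leg of `S`. [cite: ChristandlVranaZuiddam2023, Example 1.4] -/
@[simp] theorem merge_apply_pos (r : {j // p j} → ι) (c : {j // ¬p j} → ι) (j : {j // p j}) :
    merge p r c j = r j := by
  simp [merge, j.2]

/-- `merge` on a leg of `Sᶜ`. [cite: ChristandlVranaZuiddam2023, Example 1.4] -/
@[simp] theorem merge_apply_neg (r : {j // p j} → ι) (c : {j // ¬p j} → ι) (j : {j // ¬p j}) :
    merge p r c j = c j := by
  simp [merge, j.2]

/-- `merge` is the inverse of restricting to `S` and `Sᶜ` (`Equiv.piEquivPiSubtypeProd`).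
[cite: ChristandlVranaZuiddam2023, Example 1.4] -/
theorem merge_eq_symm (r : {j // p j} → ι) (c : {j // ¬p j} → ι) :
    merge p r c = (Equiv.piEquivPiSubtypeProd p (fun _ => ι)).symm (r, c) := rfl

/-- Every multi-index is a `merge`. [cite: ChristandlVranaZuiddam2023, Example 1.4] -/
theorem merge_restrict (i : Fin d → ι) : merge p (fun j => i j) (fun j => i j) = i := by
  funext j
  by_cases h : p j <;> simp [merge, h]

/-- The **flattening of a `d`-tensor along the split `S ⊔ Sᶜ` of its legs**: rows indexed by the
`S`-multi-indices, columns by the `Sᶜ`-multi-indices. [cite: ChristandlVranaZuiddam2023, Example 1.4] -/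
def flatS (t : (Fin d → ι) → K) : Matrix ({j // p j} → ι) ({j // ¬p j} → ι) K :=
  Matrix.of fun r c => t (merge p r c)

/-- Entries of the flattening. [cite: ChristandlVranaZuiddam2023, Example 1.4] -/
@[simp] theorem flatS_apply_apply (t : (Fin d → ι) → K) (r : {j // p j} → ι) (c : {j // ¬p j} → ι) :
    flatS p t r c = t (merge p r c) := rfl

variable [CommSemiring K]

/-- `⊗_{j ∈ S} A_j` as a matrix on `S`-multi-indices. [cite: ChristandlVranaZuiddam2023, Example 1.4] -/
def rowMat (A : Fin d → κ → ι → K) : Matrix ({j // p j} → κ) ({j // p j} → ι) K :=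
  Matrix.of fun r k => ∏ j : {j // p j}, A j (r j) (k j)

/-- `⊗_{j ∉ S} A_j` as a matrix on `Sᶜ`-multi-indices. [cite: ChristandlVranaZuiddam2023, Example 1.4] -/
def colMat (A : Fin d → κ → ι → K) : Matrix ({j // ¬p j} → κ) ({j // ¬p j} → ι) K :=
  Matrix.of fun c k => ∏ j : {j // ¬p j}, A j (c j) (k j)

/-- Entries of `rowMat`. [cite: ChristandlVranaZuiddam2023, Example 1.4] -/
@[simp] theorem rowMat_apply (A : Fin d → κ → ι → K) (r : {j // p j} → κ) (k : {j // p j} → ι) :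
    rowMat p A r k = ∏ j : {j // p j}, A j (r j) (k j) := rfl

/-- Entries of `colMat`. [cite: ChristandlVranaZuiddam2023, Example 1.4] -/
@[simp] theorem colMat_apply (A : Fin d → κ → ι → K) (c : {j // ¬p j} → κ) (k : {j // ¬p j} → ι) :
    colMat p A c k = ∏ j : {j // ¬p j}, A j (c j) (k j) := rfl

/-- **`flat_S (A·t) = (⊗_S A) · flat_S t · (⊗_{Sᶜ} A)ᵀ`.** [cite: ChristandlVranaZuiddam2023, Example 1.4] -/
theorem flatS_apply [Fintype ι] (A : Fin d → κ → ι → K) (t : (Fin d → ι) → K) :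
    flatS p (apply A t) = rowMat p A * flatS p t * (colMat p A).transpose := by
  ext r c
  simp only [flatS_apply_apply, Matrix.mul_apply, Matrix.transpose_apply, rowMat_apply, colMat_apply,
    apply_apply_eq]
  rw [← (Equiv.piEquivPiSubtypeProd p (fun _ => ι)).symm.sum_comp, Fintype.sum_prod_type,
    Finset.sum_comm]
  refine Finset.sum_congr rfl fun kc _ => ?_
  rw [Finset.sum_mul]
  refine Finset.sum_congr rfl fun kr _ => ?_
  rw [← merge_eq_symm, ← Fintype.prod_subtype_mul_prod_subtype p
    (fun j => A j (merge p r c j) (merge p kr kc j))]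
  simp only [merge_apply_pos, merge_apply_neg]
  ring

/-- `flat_S` is additive. [cite: ChristandlVranaZuiddam2023, Example 1.4] -/
theorem flatS_add (t t' : (Fin d → ι) → K) : flatS p (t + t') = flatS p t + flatS p t' := rfl

end Defs

section Rank

variable {K : Type u} [Field K] {d : ℕ} (p : Fin d → Prop) [DecidablePred p]
variable {ι ι' κ : Type*}

/-- **`ζ^{(S)}` is monotone under the action**: `rank flat_S (A·t) ≤ rank flat_S t`.
[cite: ChristandlVranaZuiddam2023, Example 1.4] -/
theorem rank_flatS_apply_le [Fintype ι] [Fintype κ] (A : Fin d → κ → ι → K) (t : (Fin d → ι) → K) :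
    (flatS p (apply A t)).rank ≤ (flatS p t).rank := by
  rw [flatS_apply]
  exact (Matrix.rank_mul_le_left _ _).trans (Matrix.rank_mul_le_right _ _)

/-- **`ζ^{(S)}` is monotone under restriction** ("monotone under restriction `≥`").
[cite: ChristandlVranaZuiddam2023, Example 1.4] -/
theorem rank_flatS_mono [Fintype ι] [Fintype κ] {t : (Fin d → ι) → K} {s : (Fin d → κ) → K}
    (h : Restricts t s) : (flatS p s).rank ≤ (flatS p t).rank := by
  obtain ⟨A, rfl⟩ := h
  exact rank_flatS_apply_le p A t

/-- `ζ^{(S)}` is invariant under relabelling the index set. [cite: ChristandlVranaZuiddam2023, Example 1.4] -/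
theorem rank_flatS_reindex [Fintype ι] [Fintype ι'] (e : ι ≃ ι') (t : (Fin d → ι) → K) :
    (flatS p (reindex e t)).rank = (flatS p t).rank := by
  classical
  apply le_antisymm
  · exact rank_flatS_mono p (restricts_reindex e t)
  · exact rank_flatS_mono p (reindex_restricts e t)

/-! ### Multiplicativity: the rank of a Kronecker product -/

/-- **`rank (A ⊗ₖ B) = rank A · rank B`** over a field: the rows of `A ⊗ₖ B` are the outer products of
the rows of `A` and of `B` (the tree's `OuterProductRank.finrank_span_outerFun`). [cite: ChristandlVranaZuiddam2023, Example 1.4] -/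
theorem rank_kroneckerMap_mul {m n m' n' : Type*} [Fintype m] [Fintype n] [Fintype m'] [Fintype n']
    (A : Matrix m n K) (B : Matrix m' n' K) :
    (Matrix.kroneckerMap (· * ·) A B).rank = A.rank * B.rank := by
  rw [Matrix.rank_eq_finrank_span_row, Matrix.rank_eq_finrank_span_row,
    Matrix.rank_eq_finrank_span_row]
  exact OuterProductRank.finrank_span_outerFun (fun i => A.row i) (fun i => B.row i)

/-- **`flat_S (t ⊗ t')` is the Kronecker product `flat_S t ⊗ₖ flat_S t'`** up to relabelling rows and
columns (`(S → ι × ι') ≃ (S → ι) × (S → ι')`). [cite: ChristandlVranaZuiddam2023, Example 1.4] -/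
theorem flatS_kron (t : (Fin d → ι) → K) (t' : (Fin d → ι') → K) :
    flatS p (kron t t') = Matrix.reindex
      (Equiv.arrowProdEquivProdArrow _ _ _).symm (Equiv.arrowProdEquivProdArrow _ _ _).symm
      (Matrix.kroneckerMap (· * ·) (flatS p t) (flatS p t')) := by
  ext r c
  simp only [flatS_apply_apply, kron_apply, Matrix.reindex_apply, Matrix.submatrix_apply,
    Equiv.symm_symm, Matrix.kroneckerMap_apply]
  congr 1
  · congr 1
    funext j
    by_cases h : p j <;> simp [merge, h, Equiv.arrowProdEquivProdArrow]
  · congr 1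
    funext j
    by_cases h : p j <;> simp [merge, h, Equiv.arrowProdEquivProdArrow]

/-- **`ζ^{(S)}` is multiplicative under `⊗`.** [cite: ChristandlVranaZuiddam2023, Example 1.4] -/
theorem rank_flatS_kron [Fintype ι] [Fintype ι'] (t : (Fin d → ι) → K) (t' : (Fin d → ι') → K) :
    (flatS p (kron t t')).rank = (flatS p t).rank * (flatS p t').rank := by
  rw [flatS_kron, Matrix.rank_reindex, rank_kroneckerMap_mul]

/-! ### Normalisation: the flattening of a unit tensor -/

/-- The `0/1` matrix `E : (S → ι) × ι`, `E r a = [r ≡ a]`. [cite: ChristandlVranaZuiddam2023, Example 1.4] -/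
def constMat (ι α : Type*) [DecidableEq (α → ι)] : Matrix (α → ι) ι K :=
  Matrix.of fun r a => if r = (fun _ => a) then 1 else 0

/-- Entries of `constMat`. [cite: ChristandlVranaZuiddam2023, Example 1.4] -/
@[simp] theorem constMat_apply (α : Type*) [DecidableEq (α → ι)] (r : α → ι) (a : ι) :
    constMat (K := K) ι α r a = if r = (fun _ => a) then 1 else 0 := rfl

/-- A merged multi-index is constant iff both halves are constant with the same value (`d ≠ 0`).
[cite: ChristandlVranaZuiddam2023, Example 1.4] -/
theorem merge_const_iff [NeZero d] (r : {j // p j} → ι) (c : {j // ¬p j} → ι) :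
    (∀ j j', merge p r c j = merge p r c j') ↔ ∃ a, r = (fun _ => a) ∧ c = (fun _ => a) := by
  rw [forall_eq_iff_exists_const]
  constructor
  · rintro ⟨a, ha⟩
    refine ⟨a, funext fun j => ?_, funext fun j => ?_⟩
    · have := congrFun ha j
      rwa [merge_apply_pos] at this
    · have := congrFun ha j
      rwa [merge_apply_neg] at this
  · rintro ⟨a, rfl, rfl⟩
    exact ⟨a, funext fun j => by by_cases h : p j <;> simp [merge, h]⟩

/-- **`flat_S ⟨ι⟩ = E · Fᵀ`** with `E r a = [r ≡ a]`, `F c a = [c ≡ a]` (`d ≠ 0`). [cite: ChristandlVranaZuiddam2023, Example 1.4] -/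
theorem flatS_unit [NeZero d] [Fintype ι] [DecidableEq ι] [DecidableEq ({j // p j} → ι)]
    [DecidableEq ({j // ¬p j} → ι)] :
    flatS p (unit K d ι) = constMat ι {j // p j} * (constMat (K := K) ι {j // ¬p j}).transpose := by
  ext r c
  simp only [flatS_apply_apply, unit_apply, merge_const_iff, Matrix.mul_apply, Matrix.transpose_apply,
    constMat_apply, ite_mul, one_mul, zero_mul]
  by_cases h : ∃ a, r = (fun _ => a) ∧ c = (fun _ => a)
  · obtain ⟨a, hr, hc⟩ := h
    -- the value `a` is determined by `(r, c)`: read it off leg `0`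
    have key : ∀ b, (r = fun _ => b) → (c = fun _ => b) → b = a := by
      intro b hrb hcb
      by_cases h0 : p 0
      · have h1 := congrFun hrb ⟨0, h0⟩
        have h2 := congrFun hr ⟨0, h0⟩
        exact h1.symm.trans h2
      · have h1 := congrFun hcb ⟨0, h0⟩
        have h2 := congrFun hc ⟨0, h0⟩
        exact h1.symm.trans h2
    rw [if_pos ⟨a, hr, hc⟩, Finset.sum_eq_single a]
    · rw [if_pos hr, if_pos hc]
    · intro b _ hb
      by_cases hrb : r = fun _ => b
      · rw [if_pos hrb, if_neg]
        intro hcb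
        exact hb (key b hrb hcb)
      · rw [if_neg hrb]
    · simp
  · rw [if_neg h]
    symm
    refine Finset.sum_eq_zero fun a _ => ?_
    by_cases hra : r = fun _ => a
    · rw [if_pos hra, if_neg]
      intro hca
      exact h ⟨a, hra, hca⟩
    · rw [if_neg hra]

/-- `Eᵀ · E = 1` for `E r a = [r ≡ a]` on a NONEMPTY leg set `α`. [cite: ChristandlVranaZuiddam2023, Example 1.4] -/
theorem constMat_transpose_mul_self (α : Type*) [Fintype α] [DecidableEq α] [Nonempty α] [Fintype ι]
    [DecidableEq ι] [DecidableEq (α → ι)] :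
    (constMat (K := K) ι α).transpose * constMat (K := K) ι α = 1 := by
  ext a a'
  simp only [Matrix.mul_apply, Matrix.transpose_apply, constMat_apply, Matrix.one_apply, ite_mul,
    one_mul, zero_mul, Finset.sum_ite_eq', Finset.mem_univ, if_true]
  by_cases h : a = a'
  · subst h; simp
  · rw [if_neg, if_neg h]
    intro h'
    exact h (congrFun h' (Classical.arbitrary α))

/-- **`ζ^{(S)}(⟨ι⟩) = |ι|`** for `∅ ≠ S ≠ [d]` ("normalised to have value `n` at the unit tensor `⟨n⟩`").
[cite: ChristandlVranaZuiddam2023, Example 1.4] -/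
theorem rank_flatS_unit [NeZero d] [Fintype ι] [DecidableEq ι] (hS : ∃ j, p j) (hSc : ∃ j, ¬p j) :
    (flatS p (unit K d ι)).rank = Fintype.card ι := by
  classical
  haveI : Nonempty {j // p j} := ⟨⟨hS.choose, hS.choose_spec⟩⟩
  haveI : Nonempty {j // ¬p j} := ⟨⟨hSc.choose, hSc.choose_spec⟩⟩
  rw [flatS_unit]
  apply le_antisymm
  · exact (Matrix.rank_mul_le_left _ _).trans (Matrix.rank_le_card_width _)
  · -- `Eᵀ (E Fᵀ) F = 1`
    have h1 : (constMat (K := K) ι {j // p j}).transpose *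
        (constMat ι {j // p j} * (constMat (K := K) ι {j // ¬p j}).transpose) *
        constMat (K := K) ι {j // ¬p j} = (1 : Matrix ι ι K) := by
      rw [← Matrix.mul_assoc, constMat_transpose_mul_self, Matrix.one_mul]
      exact constMat_transpose_mul_self _
    have h2 : ((constMat (K := K) ι {j // p j}).transpose *
        (constMat ι {j // p j} * (constMat (K := K) ι {j // ¬p j}).transpose) *
        constMat (K := K) ι {j // ¬p j}).rank ≤
        (constMat (K := K) ι {j // p j} * (constMat (K := K) ι {j // ¬p j}).transpose).rank :=
      (Matrix.rank_mul_le_left _ _).trans (Matrix.rank_mul_le_right _ _)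
    rw [h1, Matrix.rank_one] at h2
    exact h2

/-! ### Additivity: the flattening of a direct sum -/

/-- The `0/1` matrix of "the multi-index is the image of a multi-index under `f` on every leg":
`I_f r k = [r = f ∘ k]`. [cite: ChristandlVranaZuiddam2023, Example 1.4] -/
def indMat (α : Type*) (f : ι → κ) [DecidableEq (α → κ)] : Matrix (α → κ) (α → ι) K :=
  Matrix.of fun r k => if r = (fun j => f (k j)) then 1 else 0

/-- Entries of `indMat`. [cite: ChristandlVranaZuiddam2023, Example 1.4] -/
@[simp] theorem indMat_apply (α : Type*) (f : ι → κ) [DecidableEq (α → κ)] (r : α → κ) (k : α → ι) :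
    indMat (K := K) α f r k = if r = (fun j => f (k j)) then 1 else 0 := rfl

omit [DecidablePred p] in
/-- A product of Kronecker deltas over a finite leg set is the delta of the multi-indices.
[cite: ChristandlVranaZuiddam2023, Example 1.4] -/
theorem prod_ite_eq_eq' {α : Type*} [Fintype α] [DecidableEq κ] [DecidableEq (α → κ)] (r r₀ : α → κ) :
    (∏ j, if r j = r₀ j then (1 : K) else 0) = if r = r₀ then 1 else 0 := by
  rw [Fintype.prod_boole]
  by_cases h : r = r₀
  · simp [h]
  · have : ¬ ∀ j, r j = r₀ j := fun h' => h (funext h')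
    simp [h, this]

/-- `⊗_S E_f = I_f` on the `S`-multi-indices. [cite: ChristandlVranaZuiddam2023, Example 1.4] -/
theorem rowMat_embedMat [DecidableEq κ] [DecidableEq ({j // p j} → κ)] (f : ι → κ) :
    rowMat p (fun _ => embedMat (K := K) f) = indMat {j // p j} f := by
  ext r k
  simp only [rowMat_apply, embedMat_apply, indMat_apply]
  exact prod_ite_eq_eq' r (fun j => f (k j))

/-- `⊗_{Sᶜ} E_f = I_f` on the `Sᶜ`-multi-indices. [cite: ChristandlVranaZuiddam2023, Example 1.4] -/
theorem colMat_embedMat [DecidableEq κ] [DecidableEq ({j // ¬p j} → κ)] (f : ι → κ) :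
    colMat p (fun _ => embedMat (K := K) f) = indMat {j // ¬p j} f := by
  ext c k
  simp only [colMat_apply, embedMat_apply, indMat_apply]
  exact prod_ite_eq_eq' c (fun j => f (k j))

/-- `flat_S (E_f · t) = I_f · flat_S t · I_fᵀ`. [cite: ChristandlVranaZuiddam2023, Example 1.4] -/
theorem flatS_apply_embedMat [Fintype ι] [DecidableEq κ] [DecidableEq ({j // p j} → κ)]
    [DecidableEq ({j // ¬p j} → κ)] (f : ι → κ) (t : (Fin d → ι) → K) :
    flatS p (apply (fun _ => embedMat (K := K) f) t) =
      indMat {j // p j} f * flatS p t * (indMat {j // ¬p j} f).transpose := by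
  rw [flatS_apply, rowMat_embedMat, colMat_embedMat]

omit [DecidablePred p] in
/-- `I_fᵀ · I_f = 1` for `f` injective. [cite: ChristandlVranaZuiddam2023, Example 1.4] -/
theorem indMat_transpose_mul_self {α : Type*} [Fintype α] [DecidableEq α] [Fintype ι] [Fintype κ]
    [DecidableEq ι] [DecidableEq κ] [DecidableEq (α → κ)] {f : ι → κ} (hf : Function.Injective f) :
    (indMat (K := K) α f).transpose * indMat (K := K) α f = 1 := by
  ext k k'
  simp only [Matrix.mul_apply, Matrix.transpose_apply, indMat_apply, Matrix.one_apply, ite_mul, one_mul,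
    zero_mul, Finset.sum_ite_eq', Finset.mem_univ, if_true]
  have hinj : ((fun j => f (k j)) = fun j => f (k' j)) ↔ k = k' :=
    ⟨fun h => funext fun j => hf (congrFun h j), fun h => by rw [h]⟩
  simp only [hinj]

omit [DecidablePred p] in
/-- `I_fᵀ · I_g = 0` when `f` and `g` have disjoint images and the leg set is nonempty.
[cite: ChristandlVranaZuiddam2023, Example 1.4] -/
theorem indMat_transpose_mul_of_disjoint {α : Type*} [Fintype α] [DecidableEq α] [Nonempty α] [Fintype ι]
    [Fintype ι'] [Fintype κ] [DecidableEq κ] [DecidableEq (α → κ)] {f : ι → κ} {g : ι' → κ}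
    (hfg : ∀ a b, f a ≠ g b) :
    (indMat (K := K) α f).transpose * indMat (K := K) α g = 0 := by
  ext k k'
  simp only [Matrix.mul_apply, Matrix.transpose_apply, indMat_apply, Matrix.zero_apply, ite_mul, one_mul,
    zero_mul, Finset.sum_ite_eq', Finset.mem_univ, if_true]
  rw [if_neg]
  intro h
  exact hfg (k (Classical.arbitrary α)) (k' (Classical.arbitrary α)) (congrFun h (Classical.arbitrary α))

omit [DecidablePred p] in
/-- **Rank of a sum with orthogonal supports**: if `P₁ᵀP₁ = 1`, `Q₁ᵀQ₁ = 1`, `P₁ᵀP₂ = 0`, `Q₁ᵀQ₂ = 0`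
(and symmetrically), then `rank (P₁ M Q₁ᵀ + P₂ M' Q₂ᵀ) = rank M + rank M'` — the block-diagonal rank
formula in coordinates free of block types. [cite: ChristandlVranaZuiddam2023, Example 1.4] -/
theorem rank_add_of_orthogonal {m n m₁ n₁ m₂ n₂ : Type*} [Fintype m] [Fintype n] [Fintype m₁]
    [Fintype n₁] [Fintype m₂] [Fintype n₂] [DecidableEq m₁] [DecidableEq n₁] [DecidableEq m₂]
    [DecidableEq n₂] (P₁ : Matrix m m₁ K) (Q₁ : Matrix n n₁ K) (P₂ : Matrix m m₂ K)
    (Q₂ : Matrix n n₂ K) (M : Matrix m₁ n₁ K) (M' : Matrix m₂ n₂ K) (hP₁ : P₁.transpose * P₁ = 1)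
    (hQ₁ : Q₁.transpose * Q₁ = 1) (hP₂ : P₂.transpose * P₂ = 1) (hQ₂ : Q₂.transpose * Q₂ = 1)
    (hP : P₁.transpose * P₂ = 0) (hQ : Q₁.transpose * Q₂ = 0) :
    (P₁ * M * Q₁.transpose + P₂ * M' * Q₂.transpose).rank = M.rank + M'.rank := by
  -- transposed orthogonality relations
  have hP' : P₂.transpose * P₁ = 0 := by
    have := congrArg Matrix.transpose hP
    rwa [Matrix.transpose_mul, Matrix.transpose_transpose, Matrix.transpose_zero] at this
  have hQ' : Q₂.transpose * Q₁ = 0 := by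
    have := congrArg Matrix.transpose hQ
    rwa [Matrix.transpose_mul, Matrix.transpose_transpose, Matrix.transpose_zero] at this
  set X := P₁ * M * Q₁.transpose with hX
  set Y := P₂ * M' * Q₂.transpose with hY
  -- `rank X = rank M`, `rank Y = rank M'`
  have hXM : X.rank = M.rank := by
    apply le_antisymm
    · exact (Matrix.rank_mul_le_left _ _).trans (Matrix.rank_mul_le_right _ _)
    · have e : P₁.transpose * X * Q₁ = M := by
        simp only [hX, Matrix.mul_assoc]
        rw [← Matrix.mul_assoc P₁.transpose, hP₁, Matrix.one_mul, hQ₁, Matrix.mul_one]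
      have := (Matrix.rank_mul_le_left (P₁.transpose * X) Q₁).trans (Matrix.rank_mul_le_right _ _)
      rwa [e] at this
  have hYM : Y.rank = M'.rank := by
    apply le_antisymm
    · exact (Matrix.rank_mul_le_left _ _).trans (Matrix.rank_mul_le_right _ _)
    · have e : P₂.transpose * Y * Q₂ = M' := by
        simp only [hY, Matrix.mul_assoc]
        rw [← Matrix.mul_assoc P₂.transpose, hP₂, Matrix.one_mul, hQ₂, Matrix.mul_one]
      have := (Matrix.rank_mul_le_left (P₂.transpose * Y) Q₂).trans (Matrix.rank_mul_le_right _ _)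
      rwa [e] at this
  apply le_antisymm
  · -- `rank (X + Y) ≤ rank X + rank Y`
    rw [← hXM, ← hYM]
    unfold Matrix.rank
    rw [Matrix.mulVecLin_add]
    exact (Submodule.finrank_mono (LinearMap.range_add_le _ _)).trans
      (Submodule.finrank_add_le_finrank_add_finrank _ _)
  · -- `rank X + rank Y ≤ rank (X + Y)`: the ranges of `X` and `Y` are disjoint and inside the range
    -- of `X + Y`
    have hXQ : X * (Q₁ * Q₁.transpose) = X := by
      simp only [hX, Matrix.mul_assoc]
      rw [← Matrix.mul_assoc Q₁.transpose Q₁, hQ₁, Matrix.one_mul]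
    have hYQ : Y * (Q₁ * Q₁.transpose) = 0 := by
      simp only [hY, Matrix.mul_assoc]
      rw [← Matrix.mul_assoc Q₂.transpose Q₁, hQ', Matrix.zero_mul, Matrix.mul_zero, Matrix.mul_zero]
    have hXQ' : X * (Q₂ * Q₂.transpose) = 0 := by
      simp only [hX, Matrix.mul_assoc]
      rw [← Matrix.mul_assoc Q₁.transpose Q₂, hQ, Matrix.zero_mul, Matrix.mul_zero, Matrix.mul_zero]
    have hYQ' : Y * (Q₂ * Q₂.transpose) = Y := by
      simp only [hY, Matrix.mul_assoc]
      rw [← Matrix.mul_assoc Q₂.transpose Q₂, hQ₂, Matrix.one_mul]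
    have hXr : LinearMap.range X.mulVecLin ≤ LinearMap.range (X + Y).mulVecLin := by
      rintro _ ⟨v, rfl⟩
      refine ⟨(Q₁ * Q₁.transpose).mulVec v, ?_⟩
      simp only [Matrix.mulVecLin_apply, Matrix.mulVec_mulVec, Matrix.add_mul, hXQ, hYQ, add_zero]
    have hYr : LinearMap.range Y.mulVecLin ≤ LinearMap.range (X + Y).mulVecLin := by
      rintro _ ⟨v, rfl⟩
      refine ⟨(Q₂ * Q₂.transpose).mulVec v, ?_⟩
      simp only [Matrix.mulVecLin_apply, Matrix.mulVec_mulVec, Matrix.add_mul, hXQ', hYQ', zero_add]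
    have hPX : P₁.transpose * Y = 0 := by
      simp only [hY]
      rw [← Matrix.mul_assoc, ← Matrix.mul_assoc, hP, Matrix.zero_mul, Matrix.zero_mul]
    have hdisj : LinearMap.range X.mulVecLin ⊓ LinearMap.range Y.mulVecLin = ⊥ := by
      rw [Submodule.eq_bot_iff]
      rintro u ⟨⟨a, ha⟩, ⟨b, hb⟩⟩
      simp only [Matrix.mulVecLin_apply] at ha hb
      -- apply `P₁ᵀ`: `P₁ᵀ u = (M Q₁ᵀ) a` and `P₁ᵀ u = P₁ᵀ Y b = 0`
      have h1 : (M * Q₁.transpose).mulVec a = 0 := by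
        have e1 : P₁.transpose.mulVec u = (M * Q₁.transpose).mulVec a := by
          rw [← ha, Matrix.mulVec_mulVec]
          simp only [hX]
          rw [← Matrix.mul_assoc, ← Matrix.mul_assoc, hP₁, Matrix.one_mul]
        have e2 : P₁.transpose.mulVec u = 0 := by
          rw [← hb, Matrix.mulVec_mulVec, hPX, Matrix.zero_mulVec]
        rw [← e1, e2]
      rw [← ha]
      have : X = P₁ * (M * Q₁.transpose) := by simp only [hX, Matrix.mul_assoc]
      rw [this, ← Matrix.mulVec_mulVec, h1, Matrix.mulVec_zero]
    have hsup := Submodule.finrank_sup_add_finrank_inf_eq (LinearMap.range X.mulVecLin)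
      (LinearMap.range Y.mulVecLin)
    rw [hdisj, finrank_bot, add_zero] at hsup
    rw [← hXM, ← hYM]
    unfold Matrix.rank
    rw [← hsup]
    exact Submodule.finrank_mono (sup_le hXr hYr)

/-- **`ζ^{(S)}` is additive under `⊕`** for `∅ ≠ S ≠ [d]` ("additive under direct sum `⊕`").
[cite: ChristandlVranaZuiddam2023, Example 1.4] -/
theorem rank_flatS_dsum [Fintype ι] [Fintype ι'] [DecidableEq ι] [DecidableEq ι'] (hS : ∃ j, p j)
    (hSc : ∃ j, ¬p j) (t : (Fin d → ι) → K) (t' : (Fin d → ι') → K) :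
    (flatS p (dsum t t')).rank = (flatS p t).rank + (flatS p t').rank := by
  classical
  haveI : Nonempty {j // p j} := ⟨⟨hS.choose, hS.choose_spec⟩⟩
  haveI : Nonempty {j // ¬p j} := ⟨⟨hSc.choose, hSc.choose_spec⟩⟩
  rw [dsum_def, flatS_add, flatS_apply_embedMat, flatS_apply_embedMat]
  exact rank_add_of_orthogonal _ _ _ _ _ _ (indMat_transpose_mul_self Sum.inl_injective)
    (indMat_transpose_mul_self Sum.inl_injective) (indMat_transpose_mul_self Sum.inr_injective)
    (indMat_transpose_mul_self Sum.inr_injective)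
    (indMat_transpose_mul_of_disjoint fun a b => Sum.inl_ne_inr)
    (indMat_transpose_mul_of_disjoint fun a b => Sum.inl_ne_inr)

end Rank

end DTensor

/-! ## The gauge points on `T_d(K)` -/

namespace DTensorClass

open DTensor

variable {K : Type u} [Field K] {d' : ℕ} (p : Fin (d' + 2) → Prop) [DecidablePred p]
variable {ι : Type*}

/-- **`ζ^{(S)}` on classes**: the flattening rank of (a representative of) `x ∈ T_d(K)` along the split
`S ⊔ Sᶜ` of the legs (value on a chosen representative; independent of the choice, `gaugeRank_mk`).
[cite: ChristandlVranaZuiddam2023, Example 1.4] -/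
def gaugeRank (x : DTensorClass K (d' + 2)) : ℕ :=
  (flatS p (ofAntisymmetrization (· ≤ ·) x).val).rank

/-- **`ζ^{(S)}([t]) = rank (flat_S t)`** (restriction-equivalent tensors have equal flattening ranks).
[cite: ChristandlVranaZuiddam2023, Example 1.4] -/
theorem gaugeRank_mk [Fintype ι] (t : (Fin (d' + 2) → ι) → K) : gaugeRank p (mk t) = (flatS p t).rank := by
  unfold gaugeRank
  set s := ofAntisymmetrization (· ≤ ·) (mk t) with hs
  have h1 : toAntisymmetrization (· ≤ ·) s = mk t := toAntisymmetrization_ofAntisymmetrization _ _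
  have h2 : toAntisymmetrization (α := DFinTensor K (d' + 2)) (· ≤ ·) s = mk s.val :=
    Quotient.sound ⟨DFinTensor.ofFun_restricts s.val, DFinTensor.restricts_ofFun s.val⟩
  rw [h2, mk_eq_mk_iff] at h1
  exact le_antisymm (rank_flatS_mono p h1.1) (rank_flatS_mono p h1.2)

/-- `ζ^{(S)}(n) = n` for `∅ ≠ S ≠ [d]`. [cite: ChristandlVranaZuiddam2023, Example 1.4] -/
theorem gaugeRank_natCast (hS : ∃ j, p j) (hSc : ∃ j, ¬p j) (n : ℕ) :
    gaugeRank p (n : DTensorClass K (d' + 2)) = n := by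
  rw [natCast_eq_mk, gaugeRank_mk, rank_flatS_unit p hS hSc, Fintype.card_fin]

/-- `ζ^{(S)}` is monotone. [cite: ChristandlVranaZuiddam2023, Example 1.4] -/
theorem gaugeRank_mono {x y : DTensorClass K (d' + 2)} (h : x ≤ y) : gaugeRank p x ≤ gaugeRank p y := by
  induction x using ind with | _ n₁ s =>
  induction y using ind with | _ n₂ t =>
  rw [gaugeRank_mk, gaugeRank_mk]
  exact rank_flatS_mono p (mk_le_mk_iff.1 h)

/-- `ζ^{(S)}` is additive (`∅ ≠ S ≠ [d]`). [cite: ChristandlVranaZuiddam2023, Example 1.4] -/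
theorem gaugeRank_add (hS : ∃ j, p j) (hSc : ∃ j, ¬p j) (x y : DTensorClass K (d' + 2)) :
    gaugeRank p (x + y) = gaugeRank p x + gaugeRank p y := by
  induction x using ind with | _ n₁ s =>
  induction y using ind with | _ n₂ t =>
  rw [mk_add_mk, gaugeRank_mk, gaugeRank_mk, gaugeRank_mk, rank_flatS_dsum p hS hSc]

/-- `ζ^{(S)}` is multiplicative. [cite: ChristandlVranaZuiddam2023, Example 1.4] -/
theorem gaugeRank_mul (x y : DTensorClass K (d' + 2)) :
    gaugeRank p (x * y) = gaugeRank p x * gaugeRank p y := by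
  induction x using ind with | _ n₁ s =>
  induction y using ind with | _ n₂ t =>
  rw [mk_mul_mk, gaugeRank_mk, gaugeRank_mk, gaugeRank_mk, rank_flatS_kron]

/-- **The flattening rank `ζ^{(S)}` is a spectral point of `(T_d(K), ≤)`** for `∅ ≠ S ≠ [d]` (CVZ
Example 1.4: the gauge points "are universal spectral points"; here every grouping `S` of the legs).
[cite: ChristandlVranaZuiddam2023, Example 1.4] -/
theorem isSpectralPoint_gaugeRank (hS : ∃ j, p j) (hSc : ∃ j, ¬p j) :
    IsSpectralPoint (fun x y : DTensorClass K (d' + 2) => x ≤ y) (fun x => (gaugeRank p x : ℝ)) where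
  map_one := by
    have := gaugeRank_natCast (K := K) p hS hSc 1
    rw [Nat.cast_one] at this
    simp [this]
  map_add x y := by rw [gaugeRank_add p hS hSc, Nat.cast_add]
  map_mul x y := by rw [gaugeRank_mul, Nat.cast_mul]
  mono h := by exact_mod_cast gaugeRank_mono p h

/-- **`ζ^{(S)} ∈ X_d`**: the flattening ranks along any bipartition `S ⊔ Sᶜ` of the legs are points of
the asymptotic spectrum of `d`-tensors (`∅ ≠ S ≠ [d]`; CVZ Example 1.4 for `|S| = 1`, Alman–Li–Pratt
Remark 3.2 for general bipartitions). [cite: ChristandlVranaZuiddam2023, Example 1.4] -/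
theorem gaugeRank_mem_asymptoticSpectrumDTensors (hS : ∃ j, p j) (hSc : ∃ j, ¬p j) :
    (fun x => (gaugeRank p x : ℝ)) ∈ asymptoticSpectrumDTensors K d' :=
  isSpectralPoint_gaugeRank p hS hSc

/-- Consequently `Q̃(x) ≤ ζ^{(S)}(x) ≤ R̃(x)` for every `x ∈ T_d(K)` (CVZ §1.2: spectral points lie between
asymptotic subrank and asymptotic rank). [cite: ChristandlVranaZuiddam2023, Prop. 1.6] -/
theorem asympSubrankOf_le_gaugeRank_le_asympRankOf (hS : ∃ j, p j) (hSc : ∃ j, ¬p j)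
    (x : DTensorClass K (d' + 2)) :
    asympSubrankOf (fun x y : DTensorClass K (d' + 2) => x ≤ y) x ≤ gaugeRank p x ∧
      (gaugeRank p x : ℝ) ≤ asympRankOf (fun x y : DTensorClass K (d' + 2) => x ≤ y) x :=
  ⟨asympSubrankOf_le (gaugeRank_mem_asymptoticSpectrumDTensors p hS hSc) x,
    le_asympRankOf (gaugeRank_mem_asymptoticSpectrumDTensors p hS hSc) x⟩

end DTensorClass


end Literature.Computability.AlgebraicComplexity

end
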